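import Literature.AlgebraicGeometry.Resolution.BlowupChartRegTransversal
import Summits.ResolutionOfSingularities.ResolutionOfSingularities.Theorems.RadicialJungCleanModelsSufficeRoundOverLabels

/-!
# Route `RadicialJung`, crux `CleanModelsSuffice`, line `Sketch`: one round over the centre — the radicand upstairs

Helper for the registered stub `stub_gameRoundOver` (one round of the exceptionalisation game, at a point OVER
the centre) of the skeleton of `Summit.ResolutionOfSingularities.ResolutionOfSingularities.Theses.RadicialJung.CleanModelsSuffice`
(stmt-ResolutionOfSingularities-15883): the RADICAND upstairs. With chart data `Dc : ChartData φ C x` at a point `x`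
of the blow-up over the centre and the images of the old coordinates (`roundOver_map_coord`):

* `roundOver_map_radicand` — `φ^*(w ∏ u_t^{a_t}) = w' · x_i^{Σ_centre a} · (∏_{good l} e_l^{a_{σ l}} · ∏_m w_m^{a_{σ' m}})`
  with an explicit unit `w'` (the unit chart generators are absorbed into `w'`);
* `roundOver_label_prod` — the same product written over the labelled regular system `v'` of `𝒪_{V',x}` with
  exponents extended by zero;
* `roundOver_reg` — the REG clause at the new regular-type points: if no new coordinate is charged, `w'` is not a
  `p`-th power modulo `𝔪_x² + (x_i, boundary)` (`reesChart_unit_mul_prod_chartGen_pow_sub_pow_notMem_span_of_isUnit`).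
-/

noncomputable section

set_option linter.dupNamespace false -- mandated namespace of this single-conjunct summit

open CategoryTheory AlgebraicGeometry TopologicalSpace IsLocalRing
open Literature.AlgebraicGeometry.Resolution Literature.AlgebraicGeometry.Motives

namespace Summit.ResolutionOfSingularities.ResolutionOfSingularities.Theorems.RadicialJung.CleanModelsSuffice

section Radicand

variable {p : ℕ} {V V' : Scheme.{0}} {φ : V' ⟶ V} {C : V.IdealSheafData}

local notation3 "φch[" Dc "]" => reesChartBase (ChartData.x Dc (ChartData.i Dc))
  (Ideal.mem_span_range_self (f := ChartData.x Dc) (x := ChartData.i Dc))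

/-- Product with exponents extended by zero along an injection. [folklore] -/
theorem prod_pow_extend_eq {α β M : Type*} [Fintype α] [Fintype β] [DecidableEq β] [CommMonoid M]
    (f : α → β) (hf : Function.Injective f) (g : α → ℕ) (h : β → M) :
    ∏ b, h b ^ Function.extend f g 0 b = ∏ a, h (f a) ^ g a := by
  classical
  have h1 : ∏ b, h b ^ Function.extend f g 0 b =
      ∏ b ∈ Finset.univ.image f, h b ^ Function.extend f g 0 b := by
    refine (Finset.prod_subset (Finset.subset_univ _) fun b _ hb => ?_).symm
    have hb' : ¬ ∃ a, f a = b := fun ⟨a, ha⟩ => hb (ha ▸ Finset.mem_image_of_mem f (Finset.mem_univ a))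
    rw [Function.extend_apply' _ _ _ hb', Pi.zero_apply, pow_zero]
  rw [h1, Finset.prod_image fun a _ a' _ hh => hf hh]
  exact Finset.prod_congr rfl fun a _ => by rw [hf.extend_apply]

set_option maxHeartbeats 800000 in
open Classical in
/-- **The radicand upstairs** (product form). With `ψ(u₀ (σ l)) = ψ(c_l)·x_i·e_l` and
`ψ(u₀ (σ' m)) = ψ(c'_m)·w_m` (`roundOver_map_coord`), the image of `w · ∏_t u₀_t^{a_t}` is
`w' · x_i^{Σ_l a_{σ l}} · ((∏_l [l good] e_l^{a_{σ l}}) · ∏_m w_m^{a_{σ' m}})` with the UNIT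
`w' = ψ(w) · (∏ ψ(c_l)^{a} · ∏ ψ(c'_m)^{a}) · ∏_l [l not good] e_l^{a_{σ l}}`. [folklore] -/
theorem roundOver_map_radicand {x : V'} (Dc : ChartData φ C x)
    {d : ℕ} (u₀ : Fin d → V.presheaf.stalk (φ x)) (a : Fin d → ℕ) (w : V.presheaf.stalk (φ x))
    (hw : IsUnit w) (σ : Fin Dc.r → Fin d) (σ' : Fin Dc.a → Fin d)
    (hσ : Function.Injective σ) (hσ' : Function.Injective σ')
    (hrσσ' : ∀ t, t ∈ Set.range σ ∨ t ∈ Set.range σ') (hdisj : ∀ l m, σ l ≠ σ' m)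
    (cx : Fin Dc.r → (V.presheaf.stalk (φ x))ˣ) (cw : Fin Dc.a → (V.presheaf.stalk (φ x))ˣ)
    (hcx : ∀ l, (φ.stalkMap x).hom (u₀ (σ l)) =
      (φ.stalkMap x).hom ↑(cx l) * Dc.toStalk (φch[Dc] (Dc.x Dc.i)) * Dc.toStalk (Dc.gen l))
    (hcw : ∀ m, (φ.stalkMap x).hom (u₀ (σ' m)) = (φ.stalkMap x).hom ↑(cw m) * Dc.toStalk (φch[Dc] (Dc.w m))) :
    IsUnit ((φ.stalkMap x).hom w *
        ((∏ l, (φ.stalkMap x).hom ↑(cx l) ^ a (σ l)) * ∏ m, (φ.stalkMap x).hom ↑(cw m) ^ a (σ' m)) *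
        ∏ l, (if l ≠ Dc.i ∧ Dc.gen l ∈ Dc.Q then 1 else Dc.toStalk (Dc.gen l) ^ a (σ l))) ∧
      (φ.stalkMap x).hom (w * ∏ t, u₀ t ^ a t) =
        (φ.stalkMap x).hom w *
          ((∏ l, (φ.stalkMap x).hom ↑(cx l) ^ a (σ l)) * ∏ m, (φ.stalkMap x).hom ↑(cw m) ^ a (σ' m)) *
          (∏ l, (if l ≠ Dc.i ∧ Dc.gen l ∈ Dc.Q then 1 else Dc.toStalk (Dc.gen l) ^ a (σ l))) *
        Dc.toStalk (φch[Dc] (Dc.x Dc.i)) ^ (∑ l, a (σ l)) *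
        ((∏ l, (if l ≠ Dc.i ∧ Dc.gen l ∈ Dc.Q then Dc.toStalk (Dc.gen l) ^ a (σ l) else 1)) *
          ∏ m, Dc.toStalk (φch[Dc] (Dc.w m)) ^ a (σ' m)) := by
  letI := Dc.algB
  haveI := Dc.isLocalization_B
  set Ggood : Fin Dc.r → V'.presheaf.stalk x := fun l =>
    if l ≠ Dc.i ∧ Dc.gen l ∈ Dc.Q then Dc.toStalk (Dc.gen l) ^ a (σ l) else 1 with hGgood
  set Gbad : Fin Dc.r → V'.presheaf.stalk x := fun l =>
    if l ≠ Dc.i ∧ Dc.gen l ∈ Dc.Q then 1 else Dc.toStalk (Dc.gen l) ^ a (σ l) with hGbad'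
  have hsplitl : ∀ l, Dc.toStalk (Dc.gen l) ^ a (σ l) = Ggood l * Gbad l := fun l => by
    by_cases h : l ≠ Dc.i ∧ Dc.gen l ∈ Dc.Q
    · simp only [hGgood, hGbad', if_pos h, mul_one]
    · simp only [hGgood, hGbad', if_neg h, one_mul]
  have hGbad : ∀ l, IsUnit (Gbad l) := fun l => by
    by_cases h : l ≠ Dc.i ∧ Dc.gen l ∈ Dc.Q
    · simp only [hGbad', if_pos h]; exact isUnit_one
    · simp only [hGbad', if_neg h]
      refine IsUnit.pow _ ?_
      by_cases hli : l = Dc.i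
      · rw [hli, ChartData.toStalk_gen_self Dc]; exact isUnit_one
      · exact ChartData.isUnit_toStalk_gen Dc fun hQ => h ⟨hli, hQ⟩
  constructor
  · refine ((IsUnit.map _ hw).mul ((IsUnit.prod_univ_iff.mpr fun l => ?_).mul
      (IsUnit.prod_univ_iff.mpr fun m => ?_))).mul (IsUnit.prod_univ_iff.mpr fun l => hGbad l)
    · exact (IsUnit.map _ (Units.isUnit _)).pow _
    · exact (IsUnit.map _ (Units.isUnit _)).pow _
  have hbij : Function.Bijective (Sum.elim σ σ') := by
    constructor
    · rintro (l | m) (l' | m') h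
      · exact congrArg Sum.inl (hσ h)
      · exact absurd h (hdisj l m')
      · exact absurd h.symm (hdisj l' m)
      · exact congrArg Sum.inr (hσ' h)
    · intro t
      rcases hrσσ' t with ⟨l, rfl⟩ | ⟨m, rfl⟩
      · exact ⟨Sum.inl l, rfl⟩
      · exact ⟨Sum.inr m, rfl⟩
  have hprod : ∏ t, u₀ t ^ a t = (∏ l, u₀ (σ l) ^ a (σ l)) * ∏ m, u₀ (σ' m) ^ a (σ' m) := by
    rw [← (Equiv.ofBijective _ hbij).prod_comp (fun t => u₀ t ^ a t)]
    simp [Fintype.prod_sum_type]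
  have hl : ∀ l, (φ.stalkMap x).hom (u₀ (σ l) ^ a (σ l)) =
      (φ.stalkMap x).hom ↑(cx l) ^ a (σ l) * Dc.toStalk (φch[Dc] (Dc.x Dc.i)) ^ a (σ l) *
        (Ggood l * Gbad l) := fun l => by
    rw [map_pow, hcx l, mul_pow, mul_pow]
    exact congrArg _ (hsplitl l)
  have hm : ∀ m, (φ.stalkMap x).hom (u₀ (σ' m) ^ a (σ' m)) =
      (φ.stalkMap x).hom ↑(cw m) ^ a (σ' m) * Dc.toStalk (φch[Dc] (Dc.w m)) ^ a (σ' m) := fun m => by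
    rw [map_pow, hcw m, mul_pow]
  have e1 : (φ.stalkMap x).hom (w * ∏ t, u₀ t ^ a t) =
      (φ.stalkMap x).hom w * ((∏ l, (φ.stalkMap x).hom (u₀ (σ l) ^ a (σ l))) *
        ∏ m, (φ.stalkMap x).hom (u₀ (σ' m) ^ a (σ' m))) := by
    rw [map_mul, hprod, map_mul, map_prod, map_prod]
  have e2 : ∏ l, (φ.stalkMap x).hom (u₀ (σ l) ^ a (σ l)) =
      (∏ l, (φ.stalkMap x).hom ↑(cx l) ^ a (σ l)) * Dc.toStalk (φch[Dc] (Dc.x Dc.i)) ^ (∑ l, a (σ l)) *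
        ((∏ l, Ggood l) * ∏ l, Gbad l) := by
    rw [Finset.prod_congr rfl (fun l _ => hl l), Finset.prod_mul_distrib, Finset.prod_mul_distrib,
      Finset.prod_mul_distrib, Finset.prod_pow_eq_pow_sum]
  have e3 : ∏ m, (φ.stalkMap x).hom (u₀ (σ' m) ^ a (σ' m)) =
      (∏ m, (φ.stalkMap x).hom ↑(cw m) ^ a (σ' m)) * ∏ m, Dc.toStalk (φch[Dc] (Dc.w m)) ^ a (σ' m) := by
    rw [Finset.prod_congr rfl (fun m _ => hm m), Finset.prod_mul_distrib]
  refine e1.trans ?_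
  rw [e2, e3]
  ring

set_option maxHeartbeats 800000 in
open Classical in
/-- **The labelled product upstairs.** With exponents extended by zero from the labels
(`aOf none` on the exceptional coordinate, `a (σ' m)` on `w_m`, `a (σ g)` on the good `e_g`), the
product `∏_{i'} v'_{i'}^{a'_{i'}}` equals `x_i^{aOf none} · ((∏_l [l good] e_l^{a_{σ l}}) · ∏_m w_m^{a_{σ' m}})`.
[folklore] -/
theorem roundOver_label_prod {x : V'} (Dc : ChartData φ C x) {d d' : ℕ} (a : Fin d → ℕ)
    (σ : Fin Dc.r → Fin d) (σ' : Fin Dc.a → Fin d) (v' : Fin d' → V'.presheaf.stalk x)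
    (lab' : Option (Fin Dc.a ⊕ Dc.GoodGen) → Fin d') (hlab' : Function.Injective lab')
    (hv0 : v' (lab' none) = Dc.toStalk (φch[Dc] (Dc.x Dc.i)))
    (hvw : ∀ m : Fin Dc.a, v' (lab' (some (Sum.inl m))) = Dc.toStalk (φch[Dc] (Dc.w m)))
    (hve : ∀ j : Dc.GoodGen, v' (lab' (some (Sum.inr j))) = Dc.toStalk (Dc.gen j.1))
    (aOf : Option (Fin Dc.a ⊕ Dc.GoodGen) → ℕ) (haOfl : ∀ m, aOf (some (Sum.inl m)) = a (σ' m))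
    (haOfr : ∀ g : Dc.GoodGen, aOf (some (Sum.inr g)) = a (σ g.1)) :
    ∏ i', v' i' ^ Function.extend lab' aOf 0 i' =
      Dc.toStalk (φch[Dc] (Dc.x Dc.i)) ^ aOf none *
        ((∏ l, (if l ≠ Dc.i ∧ Dc.gen l ∈ Dc.Q then Dc.toStalk (Dc.gen l) ^ a (σ l) else 1)) *
          ∏ m, Dc.toStalk (φch[Dc] (Dc.w m)) ^ a (σ' m)) := by
  classical
  have h1 : ∏ i', v' i' ^ Function.extend lab' aOf 0 i' = ∏ o, v' (lab' o) ^ aOf o :=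
    prod_pow_extend_eq lab' hlab' aOf v'
  have h2 : ∏ o, v' (lab' o) ^ aOf o = v' (lab' none) ^ aOf none *
      ((∏ m, v' (lab' (some (Sum.inl m))) ^ aOf (some (Sum.inl m))) *
        ∏ g : Dc.GoodGen, v' (lab' (some (Sum.inr g))) ^ aOf (some (Sum.inr g))) := by
    simp only [Fintype.prod_option, Fintype.prod_sum_type]
  have h4 : (∏ l, (if l ≠ Dc.i ∧ Dc.gen l ∈ Dc.Q then Dc.toStalk (Dc.gen l) ^ a (σ l) else 1)) =
      ∏ l ∈ Finset.univ.filter (fun l => l ≠ Dc.i ∧ Dc.gen l ∈ Dc.Q), Dc.toStalk (Dc.gen l) ^ a (σ l) := by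
    rw [Finset.prod_filter]
  have h6 : ∏ g : Dc.GoodGen, v' (lab' (some (Sum.inr g))) ^ aOf (some (Sum.inr g)) =
      ∏ g : Dc.GoodGen, Dc.toStalk (Dc.gen g.1) ^ a (σ g.1) :=
    Finset.prod_congr rfl fun g _ => by simp only [hve g, haOfr g]
  have h7 : ∏ l ∈ Finset.univ.filter (fun l => l ≠ Dc.i ∧ Dc.gen l ∈ Dc.Q), Dc.toStalk (Dc.gen l) ^ a (σ l) =
      ∏ g : Dc.GoodGen, Dc.toStalk (Dc.gen g.1) ^ a (σ g.1) :=
    Finset.prod_subtype _ (by intro l; simp) _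
  have h3 := h6.trans (h7.symm.trans h4.symm)
  have h5 : ∏ m, v' (lab' (some (Sum.inl m))) ^ aOf (some (Sum.inl m)) =
      ∏ m, Dc.toStalk (φch[Dc] (Dc.w m)) ^ a (σ' m) :=
    Finset.prod_congr rfl fun m _ => by simp only [hvw m, haOfl m]
  have k1 := congrArg₂ (fun s t => s ^ aOf none * t) hv0 (congrArg₂ HMul.hMul h5 h3)
  refine h1.trans (h2.trans (k1.trans ?_))
  ring

open Classical in
/-- **The REG clause after one round over the centre, at the new regular-type points.** If no new
coordinate is charged at `x` (all chart generators `e_j`, `j ≠ i`, are units at `x` and the non-centre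
exponents vanish), then the new unit `w' = φ^*(w ∏ c_l^{a_l}) · ∏_j e_j^{a_j}` is not a `p`-th power modulo
`𝔪_x² + (x_i, (w_m)_{m ∈ Lab})` as soon as one centre exponent `a_{j₀}`, `j₀ ≠ i`, is prime to `p`
(`reesChart_unit_mul_prod_chartGen_pow_sub_pow_notMem_span_of_isUnit`). [folklore] -/
theorem roundOver_reg (hp : p.Prime) {x : V'} (hxC : φ x ∈ C.support) (Dc : ChartData φ C x)
    [CharP (V'.presheaf.stalk x) p]
    (w : V.presheaf.stalk (φ x)) (hw : IsUnit w)
    (cx : Fin Dc.r → (V.presheaf.stalk (φ x))ˣ) (cw : Fin Dc.a → (V.presheaf.stalk (φ x))ˣ)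
    (a : Fin Dc.r → ℕ) (b : Fin Dc.a → ℕ) (hb : ∀ m, b m = 0)
    (he : ∀ j, j ≠ Dc.i → Dc.gen j ∉ Dc.Q) {j₀ : Fin Dc.r} (hj₀ : j₀ ≠ Dc.i) (ha : ¬ p ∣ a j₀)
    (Lab : Set (Fin Dc.a)) (z : V'.presheaf.stalk x) :
    (φ.stalkMap x).hom w *
          ((∏ l, (φ.stalkMap x).hom ↑(cx l) ^ a l) * ∏ m, (φ.stalkMap x).hom ↑(cw m) ^ b m) *
        (∏ l, (if l ≠ Dc.i ∧ Dc.gen l ∈ Dc.Q then 1 else Dc.toStalk (Dc.gen l) ^ a l)) - z ^ p ∉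
      maximalIdeal (V'.presheaf.stalk x) ^ 2 ⊔
        Ideal.span (insert (Dc.toStalk (φch[Dc] (Dc.x Dc.i)))
          ((fun m => Dc.toStalk (φch[Dc] (Dc.w m))) '' Lab)) := by
  classical
  letI := Dc.algB
  haveI := Dc.isLocalization_B
  letI := Dc.algA
  haveI := Dc.isLocalization_A
  -- the element is `φ^*(u) ∏_j e_j^{a_j}` for the unit `u = w ∏ c_l^{a_l}`
  have hprod1 : ∏ m, (φ.stalkMap x).hom ↑(cw m) ^ b m = 1 :=
    Finset.prod_eq_one fun m _ => by rw [hb m, pow_zero]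
  have hprod2 : ∏ l, (if l ≠ Dc.i ∧ Dc.gen l ∈ Dc.Q then 1 else Dc.toStalk (Dc.gen l) ^ a l) =
      ∏ l, Dc.toStalk (Dc.gen l) ^ a l :=
    Finset.prod_congr rfl fun l _ => if_neg fun h => he l h.1 h.2
  have hu : IsUnit (w * ↑(∏ l, cx l ^ a l)) := hw.mul (Units.isUnit _)
  have helem : (φ.stalkMap x).hom w *
          ((∏ l, (φ.stalkMap x).hom ↑(cx l) ^ a l) * ∏ m, (φ.stalkMap x).hom ↑(cw m) ^ b m) *
        (∏ l, (if l ≠ Dc.i ∧ Dc.gen l ∈ Dc.Q then 1 else Dc.toStalk (Dc.gen l) ^ a l)) =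
      (φ.stalkMap x).hom (w * ↑(∏ l, cx l ^ a l)) * ∏ l, Dc.toStalk (Dc.gen l) ^ a l := by
    rw [hprod1, mul_one, hprod2, map_mul, Units.coe_prod, map_prod]
    simp only [Units.val_pow_eq_pow_val, map_pow]
  rw [helem]
  -- the hypotheses of the chart lemma
  have hψ : ∀ t : Γ(V, Dc.U), (φ.stalkMap x).hom (algebraMap Γ(V, Dc.U) (V.presheaf.stalk (φ x)) t) =
      (algebraMap _ (V'.presheaf.stalk x) : _ →+* _) (φch[Dc] t) := fun t =>
    (Dc.algebraMap_reesChartBase t).symm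
  have hwp : ∀ m ∈ Lab, Dc.w m ∈ Dc.𝔭 := fun m _ => by
    rw [← IsLocalization.AtPrime.to_map_mem_maximal_iff (V.presheaf.stalk (φ x)) Dc.𝔭 (Dc.w m)]
    rw [← Dc.hu]
    exact Ideal.subset_span ⟨Fin.natAdd Dc.r m, by simp; rfl⟩
  have hpS : ((p : ℕ) : V'.presheaf.stalk x) ∈ maximalIdeal (V'.presheaf.stalk x) := by
    rw [CharP.cast_eq_zero]; exact Ideal.zero_mem _
  exact reesChart_unit_mul_prod_chartGen_pow_sub_pow_notMem_span_of_isUnit Dc.x Dc.i Dc.𝔭 Dc.Q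
    (V'.presheaf.stalk x) (φ.stalkMap x).hom hψ Dc.hqr (Dc.reesChartBase_x_mem_Q hxC Dc.i)
    Dc.reesChartBase_mem_Q_iff Dc.w Lab hwp he hp hpS hu a hj₀ ha z

end Radicand

end Summit.ResolutionOfSingularities.ResolutionOfSingularities.Theorems.RadicialJung.CleanModelsSuffice

end
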